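import Mathlib
import Summits.ResolutionOfSingularities.ResolutionOfSingularities.Theorems.HomologicalConductorNoZenoFullSheafPunctured
import Summits.ResolutionOfSingularities.ResolutionOfSingularities.Theorems.HomologicalConductorNoZenoFullSheafCocycle
import Literature.AlgebraicGeometry.Resolution.ExceptionalCurvePoints
import HarnessLib

/-!
# Full sheaves: the stalk lattices `𝒪_{X,x} · φ(M)` are free when `Ȟ¹(M̃) = 0` (G2 (iv), chain W4.4)

`[OURS · L W4.4]` Crux `HomologicalConductor.NoZenoR` (stmt-ResolutionOfSingularities-19943; twin `NoZeno`
stmt-16483), line `sandwich-cluster`, S3 Layer 2, G-layer item **G2 (iv) «the full sheaf `M̃` is locally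
free»** (holder's cut 2026-08-27T06:00:41Z: this seat), in the G2 convention of res-D-pv-045's
`SketchG2Split.lean`: `T` a two-dimensional noetherian normal local domain, `π : X ⟶ Spec T` a resolution
(`IsResolution`: proper, birational, `X` regular), `M` a finitely generated REFLEXIVE `T`-module,
`φ : M →+ K(X)^r` injective and `T`-semilinear along `baseToFunctionField π`, `M̃ = 𝒪_X · φ(M)`
(`generatedSheaf`, p500643), and `Ȟ¹(𝒰, M̃) = 0` for every finite affine open cover (G2 (iii),
res-D-pv-024; taken here as the hypothesis `hH1` in exactly that shape).  Fourth step of the route: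

* `finite_stalkSpan_range` — the stalk lattices `𝒪_{X,y} · φ(M)` are finitely generated;
* `base_eq_closedPoint_of_isClosed`, `not_height_le_one_of_isClosed` — a closed point of `X` lies over the
  closed point of `Spec T`, a prime of height `2`;
* **`stalkSpan_eq_reflexiveHull_of_isClosed`** / **`free_stalkSpan_of_isClosed`** — at a CLOSED point the
  stalk lattice is its own reflexive hull (p506251 punctured neighbourhood + p506925 Čech cocycle), hence
  finite FREE (`free_reflexiveHull_of_isRegularLocalRing`, p503663);
* `stalkSpan_le_of_specializes`, **`free_stalkSpan`** — at an arbitrary point `y ⤳ y₁` (`y₁` closed) the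
  lattice `𝒪_{X,y} · φ(M)` is spanned by an `𝒪_{X,y₁}`-basis of `𝒪_{X,y₁} · φ(M)`, which stays
  linearly independent over `K(X)`; so **every stalk lattice of `M̃` is a finite free module**.

Replaces the role of no printed item of the manuscript under review (Hironaka 2017); AI-written, weaker
than expert review. [cite: ArtinVerdier1985, Lemma (1.1) (ii)]
-/

-- single-problem summit: the doubled namespace component `ResolutionOfSingularities` is forced
set_option linter.dupNamespace false

noncomputable section

open CategoryTheory AlgebraicGeometry TopologicalSpace Opposite
open Literature.AlgebraicGeometry.Resolution Literature.AlgebraicGeometry.Motives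
open Literature.AlgebraicGeometry.Morphisms

namespace Summit.ResolutionOfSingularities.ResolutionOfSingularities.Theorems.NoZeno.SandwichCluster.FullSheaf

variable {T : Type} [CommRing T]
variable {X : Scheme.{0}} [IsIntegral X] (π : X ⟶ Spec (.of T))
variable {M : Type} [AddCommGroup M] [Module T M] {r : ℕ} (φ : M →+ (Fin r → X.functionField))

/-! ## The base acts through every stalk; finiteness of the stalk lattices -/

/-- `a ∈ T` acts on `K(X)^r` through its germ at any point `y`: `base(a) • w = (a)_y • w`.
[folklore] -/
theorem base_smul_eq_stalk_smul (y : X) (a : T) (w : Fin r → X.functionField) :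
    baseToFunctionField π a • w = (letI := stalkModule (Fin r → X.functionField) y;
      (π.stalkMap y ((Spec.stalkIso (.of T) (π.base y)).inv
        (algebraMap T (Localization.AtPrime (π.base y).asIdeal) a))) • w) := by
  letI := stalkModule (Fin r → X.functionField) y
  rw [stalk_smul_def, ← baseToFunctionField_eq_toFunctionField_stalkMap]

/-- **The stalk lattices `𝒪_{X,y} · φ(M)` are finitely generated** (by the images of generators of `M`).
[folklore] -/
theorem finite_stalkSpan_range [IsLocallyNoetherian X] [Module.Finite T M]
    (hφ : ∀ (a : T) (m : M), φ (a • m) = baseToFunctionField π a • φ m) (y : X) :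
    (letI := stalkModule (Fin r → X.functionField) y;
      Module.Finite (X.presheaf.stalk y) (stalkSpan (Fin r → X.functionField) (Set.range φ) y)) := by
  classical
  letI := stalkModule (Fin r → X.functionField) y
  obtain ⟨n, g, hg⟩ := Module.Finite.exists_fin (R := T) (M := M)
  have hle : stalkSpan (Fin r → X.functionField) (Set.range φ) y ≤
      Submodule.span (X.presheaf.stalk y) (Set.range (fun i => φ (g i))) := by
    apply Submodule.span_le.mpr
    rintro _ ⟨m, rfl⟩
    have hm : m ∈ Submodule.span T (Set.range g) := by rw [hg]; trivial
    obtain ⟨c, rfl⟩ := (Submodule.mem_span_range_iff_exists_fun T).mp hm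
    rw [map_sum]
    refine Submodule.sum_mem _ fun i _ => ?_
    rw [hφ, base_smul_eq_stalk_smul π y]
    exact Submodule.smul_mem _ _ (Submodule.subset_span ⟨i, rfl⟩)
  haveI : Module.Finite (X.presheaf.stalk y)
      (Submodule.span (X.presheaf.stalk y) (Set.range (fun i => φ (g i)))) :=
    Module.Finite.iff_fg.mpr (Submodule.fg_span (Set.finite_range _))
  exact Module.Finite.of_injective (Submodule.inclusion hle) (Submodule.inclusion_injective hle)

/-! ## Closed points lie over the closed point -/

omit [IsIntegral X] in
/-- A closed point of `X` maps to the closed point of `Spec T` under the proper `π`. [folklore] -/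
theorem base_eq_closedPoint_of_isClosed [IsLocalRing T] [IsProper π] {y : X}
    (hy : IsClosed ({y} : Set X)) : π.base y = IsLocalRing.closedPoint T := by
  have hc : IsClosed ({π.base y} : Set (Spec (.of T))) := by
    rw [← Set.image_singleton]; exact π.isClosedMap _ hy
  have hmax : (π.base y).asIdeal.IsMaximal :=
    (PrimeSpectrum.isClosed_singleton_iff_isMaximal _).mp hc
  exact PrimeSpectrum.ext (IsLocalRing.eq_maximalIdeal hmax)

omit [IsIntegral X] in
/-- A closed point of `X` lies over a prime of height `2 > 1` (`dim T = 2`). [folklore] -/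
theorem not_height_le_one_of_isClosed [IsLocalRing T] [IsProper π] (hdim : ringKrullDim T = 2) {y : X}
    (hy : IsClosed ({y} : Set X)) : ¬ (π.base y).asIdeal.height ≤ 1 := by
  rw [base_eq_closedPoint_of_isClosed π hy]
  change ¬ (IsLocalRing.maximalIdeal T).height ≤ 1
  intro h
  have h2 := IsLocalRing.maximalIdeal_height_eq_ringKrullDim (R := T)
  rw [hdim] at h2
  have : ((IsLocalRing.maximalIdeal T).height : WithBot ℕ∞) ≤ 1 := by exact_mod_cast h
  rw [h2] at this
  exact absurd this (by decide)

/-! ## The range of `φ` as a reflexive `T`-submodule -/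

/-- The `T`-module structure on `K(X)^r` through `baseToFunctionField π` and the range of `φ` as a
reflexive `T`-submodule (packaging the G2 convention for the `N`-form lemmas). [folklore] -/
theorem exists_submodule_range (hM : Module.IsReflexive T M)
    (hφ : ∀ (a : T) (m : M), φ (a • m) = baseToFunctionField π a • φ m) (hφinj : Function.Injective φ) :
    letI : Module T (Fin r → X.functionField) :=
      Module.compHom (Fin r → X.functionField) (baseToFunctionField π)
    ∃ N : Submodule T (Fin r → X.functionField), (N : Set (Fin r → X.functionField)) = Set.range φ ∧
      Module.IsReflexive T N := by
  letI : Module T (Fin r → X.functionField) :=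
    Module.compHom (Fin r → X.functionField) (baseToFunctionField π)
  let φₗ : M →ₗ[T] (Fin r → X.functionField) :=
    { toFun := φ
      map_add' := φ.map_add
      map_smul' := fun a m => by rw [RingHom.id_apply, hφ]; rfl }
  haveI := hM
  exact ⟨LinearMap.range φₗ, LinearMap.coe_range φₗ, Module.equiv (LinearEquiv.ofInjective φₗ hφinj)⟩

/-! ## Closed points: the stalk lattice is reflexive, hence free -/

section Normal

variable [IsDomain T] [IsNoetherianRing T] [IsLocalRing T] [IsIntegrallyClosed T]

omit [IsIntegral X] [IsDomain T] [IsLocalRing T] [IsIntegrallyClosed T] in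
/-- The local rings of a resolution of a two-dimensional `T` have Krull dimension `≤ 2`. [folklore] -/
theorem ringKrullDim_stalk_le_two (hdim : ringKrullDim T = 2) (hπ : IsResolution π) (y : X) :
    ringKrullDim (X.presheaf.stalk y) ≤ 2 := by
  rw [AlgebraicGeometry.ringKrullDim_stalk_eq_coheight y]
  have h := hπ.height_add_coheight_le_two hdim.le y
  have : Order.coheight y ≤ 2 := le_trans le_add_self h
  rw [← WithBot.coe_ofNat, WithBot.coe_le_coe]
  exact this

/-- **At a closed point the stalk lattice `𝒪_{X,y₀} · φ(M)` is its own reflexive hull** (given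
`Ȟ¹(M̃) = 0` on finite affine covers): a vector of the hull is a section of `M̃` on a punctured
neighbourhood (p506251) and such a section extends (p506925). [cite: ArtinVerdier1985, Lemma (1.1) (ii)] -/
theorem stalkSpan_eq_reflexiveHull_of_isClosed [IsLocallyNoetherian X] [Module.Finite T M]
    (hdim : ringKrullDim T = 2) (hπ : IsResolution π) (hM : Module.IsReflexive T M)
    (hφ : ∀ (a : T) (m : M), φ (a • m) = baseToFunctionField π a • φ m) (hφinj : Function.Injective φ)
    (hH1 : ∀ (ι : Type) [Finite ι] (U : ι → X.Opens), (∀ i, IsAffineOpen (U i)) → ⨆ i, U i = ⊤ →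
      Subsingleton (CechMH1 π (generatedSheaf (Fin r → X.functionField) (Set.range φ)) U))
    {y₀ : X} (hy₀ : IsClosed ({y₀} : Set X)) :
    letI := stalkModule (Fin r → X.functionField) y₀
    reflexiveHull (stalkSpan (Fin r → X.functionField) (Set.range φ) y₀) =
      stalkSpan (Fin r → X.functionField) (Set.range φ) y₀ := by
  letI := stalkModule (Fin r → X.functionField) y₀
  haveI : IsProper π := hπ.isProper
  haveI : CompactSpace X := QuasiCompact.compactSpace_of_compactSpace π
  haveI : IsNoetherian X := {}
  haveI : IsRegularLocalRing (X.presheaf.stalk y₀) := hπ.isRegular y₀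
  have hdimy : ringKrullDim (X.presheaf.stalk y₀) ≤ 2 := ringKrullDim_stalk_le_two π hdim hπ y₀
  refine le_antisymm (fun h hh => ?_) (le_reflexiveHull _)
  obtain ⟨U₀, hy₀U₀, hU₀⟩ := exists_opens_forall_ne_mem_stalkSpan (Fin r → X.functionField) (Set.range φ)
    y₀ hy₀ hdimy (finite_stalkSpan_range π φ hφ y₀) hh
  letI : Module T (Fin r → X.functionField) :=
    Module.compHom (Fin r → X.functionField) (baseToFunctionField π)
  have hmod : ∀ (a : T) (w : Fin r → X.functionField), a • w = baseToFunctionField π a • w :=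
    fun a w => (rfl : (baseToFunctionField π a) • w = (baseToFunctionField π a) • w)
  obtain ⟨N, hN, hNrefl⟩ := exists_submodule_range π φ hM hφ hφinj
  haveI := hNrefl
  rw [← hN] at hU₀ hH1 ⊢
  exact mem_stalkSpan_of_forall_ne_of_cechH1 π hπ.isBirational hmod N hH1 y₀ hy₀
    (not_height_le_one_of_isClosed π hdim hy₀) U₀ hy₀U₀ hU₀

/-- **At a closed point the stalk lattice is a finite FREE `𝒪_{X,y₀}`-module** (it is its reflexive
hull, which is free over the regular two-dimensional `𝒪_{X,y₀}`, p503663). [cite: ArtinVerdier1985,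
Lemma (1.1) (ii)] -/
theorem free_stalkSpan_of_isClosed [IsLocallyNoetherian X] [Module.Finite T M]
    (hdim : ringKrullDim T = 2) (hπ : IsResolution π) (hM : Module.IsReflexive T M)
    (hφ : ∀ (a : T) (m : M), φ (a • m) = baseToFunctionField π a • φ m) (hφinj : Function.Injective φ)
    (hH1 : ∀ (ι : Type) [Finite ι] (U : ι → X.Opens), (∀ i, IsAffineOpen (U i)) → ⨆ i, U i = ⊤ →
      Subsingleton (CechMH1 π (generatedSheaf (Fin r → X.functionField) (Set.range φ)) U))
    {y₀ : X} (hy₀ : IsClosed ({y₀} : Set X)) :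
    letI := stalkModule (Fin r → X.functionField) y₀
    Module.Free (X.presheaf.stalk y₀) (stalkSpan (Fin r → X.functionField) (Set.range φ) y₀) := by
  letI := stalkModule (Fin r → X.functionField) y₀
  haveI := stalk_isScalarTower (Fin r → X.functionField) y₀
  haveI : IsProper π := hπ.isProper
  haveI : IsRegularLocalRing (X.presheaf.stalk y₀) := hπ.isRegular y₀
  have hdimy : ringKrullDim (X.presheaf.stalk y₀) ≤ 2 := ringKrullDim_stalk_le_two π hdim hπ y₀
  haveI : NoZeroSMulDivisors (X.presheaf.stalk y₀) (Fin r → X.functionField) :=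
    ⟨fun {c v} hcv => by
      rw [stalk_smul_def] at hcv
      rcases smul_eq_zero.mp hcv with h0 | h0
      · exact Or.inl ((map_eq_zero_iff _ (RatFn.toFunctionField_injective y₀)).mp h0)
      · exact Or.inr h0⟩
  haveI : FaithfulSMul (X.presheaf.stalk y₀) X.functionField :=
    (faithfulSMul_iff_algebraMap_injective _ _).mpr (RatFn.toFunctionField_injective y₀)
  haveI := finite_stalkSpan_range π φ hφ y₀
  have hfree := free_reflexiveHull_of_isRegularLocalRing X.functionField hdimy
    (stalkSpan (Fin r → X.functionField) (Set.range φ) y₀)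
  rw [stalkSpan_eq_reflexiveHull_of_isClosed π φ hdim hπ hM hφ hφinj hH1 hy₀] at hfree
  exact hfree

end Normal

/-! ## Arbitrary points: specialise to a closed point -/

omit [IsIntegral X] in
/-- The action of `𝒪_{X,y₁}` on `V` factors through `𝒪_{X,y}` for `y ⤳ y₁`. [folklore] -/
theorem stalk_smul_eq_stalkSpecializes_smul [IsIntegral X] (V : Type) [AddCommGroup V]
    [Module X.functionField V] {y y₁ : X} (h : y ⤳ y₁) (t : X.presheaf.stalk y₁) (w : V) :
    (letI := stalkModule V y₁; t • w) = (letI := stalkModule V y; (X.presheaf.stalkSpecializes h t) • w) := by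
  letI := stalkModule V y₁
  rw [stalk_smul_def]
  letI := stalkModule V y
  rw [stalk_smul_def]
  congr 1
  change _ = (X.presheaf.stalkSpecializes h ≫ X.presheaf.stalkSpecializes _).hom t
  rw [TopCat.Presheaf.stalkSpecializes_comp]
  rfl

/-- The stalk lattice grows under generisation: for `y ⤳ y₁`, `𝒪_{X,y₁} · S ⊆ 𝒪_{X,y} · S` as subsets
of `V`. [folklore] -/
theorem stalkSpan_le_of_specializes (V : Type) [AddCommGroup V] [Module X.functionField V] (S : Set V)
    {y y₁ : X} (h : y ⤳ y₁) :
    (stalkSpan V S y₁ : Set V) ⊆ (stalkSpan V S y : Set V) := by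
  letI i₁ := stalkModule V y₁
  intro v hv
  induction hv using Submodule.span_induction with
  | mem w hw => exact subset_stalkSpan V S y hw
  | zero => exact (stalkSpan V S y).zero_mem
  | add w w' _ _ hw hw' => exact (stalkSpan V S y).add_mem hw hw'
  | smul t w _ hw =>
    rw [SetLike.mem_coe, stalk_smul_eq_stalkSpecializes_smul V h t w]
    letI := stalkModule V y
    exact (stalkSpan V S y).smul_mem _ hw

section Normal

variable [IsDomain T] [IsNoetherianRing T] [IsLocalRing T] [IsIntegrallyClosed T]

/-- **Every stalk lattice `𝒪_{X,y} · φ(M)` of the full sheaf is a finite free module** (given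
`Ȟ¹(M̃) = 0` on finite affine covers): specialise `y ⤳ y₁` to a closed point; an `𝒪_{X,y₁}`-basis of
`𝒪_{X,y₁} · φ(M)` spans `𝒪_{X,y} · φ(M)` and is linearly independent over `K(X)`.
[cite: ArtinVerdier1985, Lemma (1.1) (ii)] -/
theorem free_stalkSpan [IsLocallyNoetherian X] [Module.Finite T M]
    (hdim : ringKrullDim T = 2) (hπ : IsResolution π) (hM : Module.IsReflexive T M)
    (hφ : ∀ (a : T) (m : M), φ (a • m) = baseToFunctionField π a • φ m) (hφinj : Function.Injective φ)
    (hH1 : ∀ (ι : Type) [Finite ι] (U : ι → X.Opens), (∀ i, IsAffineOpen (U i)) → ⨆ i, U i = ⊤ →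
      Subsingleton (CechMH1 π (generatedSheaf (Fin r → X.functionField) (Set.range φ)) U))
    (y : X) :
    letI := stalkModule (Fin r → X.functionField) y
    Module.Free (X.presheaf.stalk y) (stalkSpan (Fin r → X.functionField) (Set.range φ) y) := by
  let W := Fin r → X.functionField
  let S := Set.range φ
  haveI : IsProper π := hπ.isProper
  haveI : CompactSpace X := QuasiCompact.compactSpace_of_compactSpace π
  -- a closed specialisation `y₁` of `y`
  obtain ⟨y₁, hy₁, hyc⟩ : ∃ y₁ : X, y ⤳ y₁ ∧ IsClosed ({y₁} : Set X) := by
    obtain ⟨y₁, hy₁, hc⟩ :=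
      (isClosed_closure (s := ({y} : Set X))).exists_closed_singleton ⟨y, subset_closure rfl⟩
    exact ⟨y₁, specializes_iff_mem_closure.mpr hy₁, hc⟩
  letI i₁ := stalkModule W y₁
  haveI := stalk_isScalarTower W y₁
  haveI hfree₁ := free_stalkSpan_of_isClosed π φ hdim hπ hM hφ hφinj hH1 hyc
  -- an `𝒪_{X,y₁}`-basis of the lattice at `y₁`, read in `V`
  let b := Module.Free.chooseBasis (X.presheaf.stalk y₁) (stalkSpan W S y₁)
  let v : Module.Free.ChooseBasisIndex (X.presheaf.stalk y₁) (stalkSpan W S y₁) → W := fun i => (b i : W)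
  -- independent over `K(X)` (fraction field of `𝒪_{X,y₁}`)
  have hliK : LinearIndependent X.functionField v := by
    have hli₁ : LinearIndependent (X.presheaf.stalk y₁) v :=
      b.linearIndependent.map' (stalkSpan W S y₁).subtype (Submodule.ker_subtype _)
    exact (LinearIndependent.iff_fractionRing (X.presheaf.stalk y₁) X.functionField).mp hli₁
  -- hence over `𝒪_{X,y}`
  letI := stalkModule W y
  haveI := stalk_isScalarTower W y
  haveI : FaithfulSMul (X.presheaf.stalk y) X.functionField :=
    (faithfulSMul_iff_algebraMap_injective _ _).mpr (RatFn.toFunctionField_injective y)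
  have hli : LinearIndependent (X.presheaf.stalk y) v := hliK.restrict_scalars' (X.presheaf.stalk y)
  -- its span is the lattice at `y`
  have hspan : Submodule.span (X.presheaf.stalk y) (Set.range v) = stalkSpan W S y := by
    apply le_antisymm
    · rw [Submodule.span_le]
      rintro _ ⟨i, rfl⟩
      exact stalkSpan_le_of_specializes W S hy₁ (b i).2
    · change Submodule.span (X.presheaf.stalk y) S ≤ _
      rw [Submodule.span_le]
      intro w hw
      have hw₁ : w ∈ stalkSpan W S y₁ := subset_stalkSpan W S y₁ hw
      -- expand `w` in the basis `b`
      have hw' : w = Finsupp.linearCombination (X.presheaf.stalk y₁) v (b.repr ⟨w, hw₁⟩) := by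
        have h1 := congrArg Subtype.val (b.linearCombination_repr ⟨w, hw₁⟩)
        have h2 := Finsupp.apply_linearCombination (X.presheaf.stalk y₁) (stalkSpan W S y₁).subtype
          b (b.repr ⟨w, hw₁⟩)
        exact h1.symm.trans h2
      rw [SetLike.mem_coe, hw', Finsupp.linearCombination_apply, Finsupp.sum]
      refine Submodule.sum_mem _ fun i _ => ?_
      rw [stalk_smul_eq_stalkSpecializes_smul W hy₁]
      exact Submodule.smul_mem _ _ (Submodule.subset_span ⟨i, rfl⟩)
  exact Module.Free.of_basis ((Module.Basis.span hli).map (LinearEquiv.ofEq _ _ hspan))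

end Normal

end Summit.ResolutionOfSingularities.ResolutionOfSingularities.Theorems.NoZeno.SandwichCluster.FullSheaf

end
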